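import Literature.Analysis.ODE.TorusFlowFrameRegularity
import Literature.Analysis.ODE.TorusFlowHigherDerivatives
import HarnessLib

/-!
# The flow of a field continuous in time and smooth in space: ALL-ORDER space derivatives of the
# displacement — `∂^l D(s) = ∫₀ˢ ∂^l (b ∘ X)`, the chain rule on steroids WITHIN the window

Analysis/ODE proof file (theorems only; no definitions, no named facts). Setting of
`TorusFlowFrameRegularity` (generic dimension): a velocity field `b : ℝ × T^d → ℝ^d` and a displacement
`D : ℝ × T^d → ℝ^d` on the window `[0,T]` with space–time lifts continuous on `[0,T] × ℝ^d`, smooth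
slices, order-by-order bounds `‖Dⁿ(lift (b t))‖, ‖Dⁿ(lift (D t))‖ ≤ C_n` uniform in `t ∈ [0,T]` (the clauses
(L1), (L3), (F1) of `LagrangianLatticeCarrier.LevelRegular` on a refresh window), and the flow equation in
integral form `D(s, x) = ∫₀ˢ b(r, x + proj D(r, x)) dr`. That file proves the variational equation at ORDER
ONE (FR4). Here the same method — Landau joint continuity of space derivatives
(`Torus.continuousOn_stLift_iterPartialDeriv_and_bounds`), differentiation of the integral form under the
integral sign along label lines, and the fundamental theorem of calculus within `[0,T]` — is run at ALL
ORDERS: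

* §1 the composite `u(r, x) := b(r, x + proj D(r,x))` inherits the three clauses (joint continuity,
  smooth slices, time-uniform all-order bounds — the last by Mathlib's `norm_iteratedFDeriv_comp_le`);
* §2 `iterPartialDeriv_disp_eq_integral`: `∂^l D(s)(x) = ∫₀ˢ ∂^l u(r)(x) dr` for every word `l`;
* §3 `hasDerivWithinAt_iterPartialDeriv_disp`: for every word `l`, component `i`, label `x` and
  `s ∈ [0,T]`, `∂ₛ ∂^l Dᵢ(s, x) = ∂^l [y ↦ bᵢ(s, y + proj D(s,y))](x)` as a derivative WITHIN `[0,T]` —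
  Armstrong–Vicol's "(eq:chain:rule:steroids)" (App. A Prop. 7.11) in exactly the hypothesis shape `hDt`
  of the within-window flow estimate `TorusFlow.dnorm_flowGrad_le_forward_ofDerivWithin`.

Consumer: the analytic tower of the Lagrangian carriers of cell `ad-ideate` (K1L_D
`stmt-AnomalousDissipation-27980`, W3-E (ii) `stub_effectiveFrameEnergyL_bandKill`).

## References

* P. Hartman, *Ordinary Differential Equations*, 2nd ed., SIAM 2002, Ch. V Thm. 3.1 and Cor. 3.1
  (higher differentiability of solutions in the initial data; the variational equations). [`Hartman2002`]
* S. Armstrong, V. Vicol, *Anomalous diffusion by fractal homogenization*, Ann. PDE 11 (2025),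
  arXiv:2305.05048, App. A Prop. 7.11 (proof, (eq:chain:rule:steroids)). [`ArmstrongVicol2025`]
-/

noncomputable section

open Set Function Filter MeasureTheory intervalIntegral
open scoped Topology ContDiff Interval

namespace Literature.Analysis.ODE

namespace TorusFlow

open Literature.Analysis.FunctionSpaces Literature.Analysis.FunctionSpaces.Torus

variable {d : Type*} [Fintype d] [DecidableEq d]

/-! ## §0 Tools -/

omit [Fintype d] [DecidableEq d] in
/-- `lift (h(· + proj E ·)) = lift h ∘ (id + lift E)`. [folklore] -/
private theorem lift_comp_add_proj_h {F : Type*} (h : UnitAddTorus d → F)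
    (E : UnitAddTorus d → EuclideanSpace ℝ d) :
    lift (fun y => h (y + proj (E y))) = lift h ∘ fun v => v + lift E v := by
  funext v
  rw [lift_apply, comp_apply, lift_apply, proj_add, lift_apply]

/-- Uniform-in-order packaging: from `∀ n, ∃ C_n` to one constant `C ≥ 0` for all orders `≤ n`. [folklore] -/
private theorem exists_uniform_bound {ι : Type*} {S : Set ι} {N : ι → ℕ → ℝ}
    (h : ∀ n : ℕ, ∃ C : ℝ, ∀ t ∈ S, N t n ≤ C) (n : ℕ) :
    ∃ C : ℝ, 0 ≤ C ∧ ∀ i, i ≤ n → ∀ t ∈ S, N t i ≤ C := by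
  induction n with
  | zero =>
    obtain ⟨C, hC⟩ := h 0
    exact ⟨max C 0, le_max_right _ _, fun i hi t ht => by
      obtain rfl : i = 0 := Nat.le_zero.mp hi; exact (hC t ht).trans (le_max_left _ _)⟩
  | succ n ih =>
    obtain ⟨C, hC0, hC⟩ := ih
    obtain ⟨C', hC'⟩ := h (n + 1)
    refine ⟨max C C', le_max_of_le_left hC0, fun i hi t ht => ?_⟩
    rcases Nat.lt_or_ge i (n + 1) with hlt | hge
    · exact (hC i (Nat.lt_succ_iff.mp hlt) t ht).trans (le_max_left _ _)
    · obtain rfl : i = n + 1 := le_antisymm hi hge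
      exact (hC' t ht).trans (le_max_right _ _)

omit [DecidableEq d] in
/-- The iterated derivatives of `v ↦ v + lift E v`: order `i ≥ 1` bounded by `1 + ‖Dⁱ(lift E)‖`. [folklore] -/
private theorem norm_iteratedFDeriv_id_add_lift_le {E : UnitAddTorus d → EuclideanSpace ℝ d} (hE : IsSmooth E)
    {i : ℕ} (hi : 1 ≤ i) (v : EuclideanSpace ℝ d) :
    ‖iteratedFDeriv ℝ i (fun w => w + lift E w) v‖ ≤ 1 + ‖iteratedFDeriv ℝ i (lift E) v‖ := by
  have hid : ContDiff ℝ ∞ (fun w : EuclideanSpace ℝ d => w) := contDiff_id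
  have hEc : ContDiff ℝ ∞ (lift E) := hE
  have e1 : iteratedFDeriv ℝ i (fun w => w + lift E w) v =
      iteratedFDeriv ℝ i (fun w : EuclideanSpace ℝ d => w) v + iteratedFDeriv ℝ i (lift E) v :=
    iteratedFDeriv_add_apply (hid.contDiffAt.of_le (by exact_mod_cast le_top))
      (hEc.contDiffAt.of_le (by exact_mod_cast le_top))
  rw [e1]
  refine (norm_add_le _ _).trans (add_le_add ?_ le_rfl)
  -- `‖Dⁱ id‖ ≤ 1`
  obtain ⟨i, rfl⟩ := Nat.exists_eq_add_of_le' hi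
  rw [← norm_iteratedFDeriv_fderiv]
  have hf : _root_.fderiv ℝ (fun w : EuclideanSpace ℝ d => w) = fun _ => ContinuousLinearMap.id ℝ _ := by
    funext w; exact fderiv_id
  rw [hf]
  rcases Nat.eq_zero_or_pos i with rfl | hi0
  · rw [norm_iteratedFDeriv_zero]; exact ContinuousLinearMap.norm_id_le
  · rw [iteratedFDeriv_const_of_ne (Nat.pos_iff_ne_zero.mp hi0)]
    simp only [Pi.zero_apply, norm_zero]
    exact zero_le_one

/-! ## §1 The composite `u(r, x) = b(r, x + proj D(r, x))` inherits the three clauses -/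

variable {b D : ℝ → UnitAddTorus d → EuclideanSpace ℝ d} {T : ℝ}

omit [DecidableEq d] in
/-- Joint continuity of the composite. [cite: Hartman2002, Ch. V Thm. 3.1 (setting)] -/
theorem continuousOn_stLift_comp_flow (hbc : ContinuousOn (stLift b) (Icc 0 T ×ˢ univ))
    (hDc : ContinuousOn (stLift D) (Icc 0 T ×ˢ univ)) :
    ContinuousOn (stLift fun r x => b r (x + proj (D r x))) (Icc 0 T ×ˢ univ) := by
  have hmap : ContinuousOn (fun p : ℝ × EuclideanSpace ℝ d => (p.1, p.2 + stLift D p)) (Icc 0 T ×ˢ univ) :=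
    continuousOn_fst.prodMk (continuousOn_snd.add hDc)
  refine (hbc.comp hmap fun p hp => mk_mem_prod (mem_prod.1 hp).1 (mem_univ _)).congr fun p hp => ?_
  obtain ⟨r, y⟩ := p
  simp only [comp_apply, stLift_apply, proj_add]

omit [DecidableEq d] in
/-- Smooth slices of the composite. [cite: Hartman2002, Ch. V Thm. 3.1 (setting)] -/
theorem isSmooth_comp_flow (hbs : ∀ t ∈ Icc 0 T, IsSmooth (b t)) (hDs : ∀ t ∈ Icc 0 T, IsSmooth (D t))
    {r : ℝ} (hr : r ∈ Icc 0 T) : IsSmooth (fun x => b r (x + proj (D r x))) :=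
  isSmooth_comp_add_proj (hbs r hr) (hDs r hr)

omit [DecidableEq d] in
/-- **Time-uniform all-order bounds of the composite** (`‖Dⁿ(g ∘ f)‖ ≤ n!·C·Dⁿ`). [cite: Hartman2002, Ch. V Cor. 3.1 (a priori bounds)] -/
theorem exists_norm_iteratedFDeriv_comp_flow_le (hbs : ∀ t ∈ Icc 0 T, IsSmooth (b t))
    (hbB : ∀ n : ℕ, ∃ C : ℝ, ∀ t ∈ Icc 0 T, ∀ y, ‖iteratedFDeriv ℝ n (lift (b t)) y‖ ≤ C)
    (hDs : ∀ t ∈ Icc 0 T, IsSmooth (D t))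
    (hDB : ∀ n : ℕ, ∃ C : ℝ, ∀ t ∈ Icc 0 T, ∀ y, ‖iteratedFDeriv ℝ n (lift (D t)) y‖ ≤ C) (n : ℕ) :
    ∃ C : ℝ, ∀ t ∈ Icc 0 T, ∀ y, ‖iteratedFDeriv ℝ n (lift fun x => b t (x + proj (D t x))) y‖ ≤ C := by
  -- one constant for all orders `≤ n`, uniformly in `t` and the point
  obtain ⟨Cb, hCb0, hCb⟩ := exists_uniform_bound (S := Icc 0 T ×ˢ (univ : Set (EuclideanSpace ℝ d)))
    (N := fun p i => ‖iteratedFDeriv ℝ i (lift (b p.1)) p.2‖)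
    (fun i => by obtain ⟨C, hC⟩ := hbB i; exact ⟨C, fun p hp => hC p.1 (mem_prod.1 hp).1 p.2⟩) n
  obtain ⟨CD, hCD0, hCD⟩ := exists_uniform_bound (S := Icc 0 T ×ˢ (univ : Set (EuclideanSpace ℝ d)))
    (N := fun p i => ‖iteratedFDeriv ℝ i (lift (D p.1)) p.2‖)
    (fun i => by obtain ⟨C, hC⟩ := hDB i; exact ⟨C, fun p hp => hC p.1 (mem_prod.1 hp).1 p.2⟩) n
  refine ⟨(Nat.factorial n : ℝ) * Cb * (1 + CD) ^ n, fun t ht y => ?_⟩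
  rw [lift_comp_add_proj_h]
  have hg : ContDiff ℝ n (lift (b t)) := (hbs t ht).of_le (by exact_mod_cast le_top)
  have hf : ContDiff ℝ n (fun w : EuclideanSpace ℝ d => w + lift (D t) w) :=
    (contDiff_id.add (hDs t ht)).of_le (by exact_mod_cast le_top)
  refine norm_iteratedFDeriv_comp_le hg hf le_rfl y (fun i hi => hCb i hi (t, _) (mk_mem_prod ht (mem_univ _))) ?_
  intro i hi1 hin
  calc ‖iteratedFDeriv ℝ i (fun w => w + lift (D t) w) y‖ ≤ 1 + ‖iteratedFDeriv ℝ i (lift (D t)) y‖ :=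
        norm_iteratedFDeriv_id_add_lift_le (hDs t ht) hi1 y
    _ ≤ 1 + CD := add_le_add le_rfl (hCD i hin (t, y) (mk_mem_prod ht (mem_univ _)))
    _ ≤ (1 + CD) ^ i := by
        have h1 : (1 : ℝ) ≤ 1 + CD := by linarith
        calc 1 + CD = (1 + CD) ^ 1 := (pow_one _).symm
          _ ≤ (1 + CD) ^ i := pow_le_pow_right₀ h1 hi1

/-- The package of §1 fed to the Landau interpolation: every word derivative of the composite has a jointly
continuous space–time lift on `[0,T] × ℝ^d` and time-uniform all-order bounds.
[cite: Landau1913, Satz 1 (application); Hartman2002, Ch. V Thm. 3.1] -/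
theorem continuousOn_stLift_iterPartialDeriv_comp_flow (hbc : ContinuousOn (stLift b) (Icc 0 T ×ˢ univ))
    (hbs : ∀ t ∈ Icc 0 T, IsSmooth (b t))
    (hbB : ∀ n : ℕ, ∃ C : ℝ, ∀ t ∈ Icc 0 T, ∀ y, ‖iteratedFDeriv ℝ n (lift (b t)) y‖ ≤ C)
    (hDc : ContinuousOn (stLift D) (Icc 0 T ×ˢ univ)) (hDs : ∀ t ∈ Icc 0 T, IsSmooth (D t))
    (hDB : ∀ n : ℕ, ∃ C : ℝ, ∀ t ∈ Icc 0 T, ∀ y, ‖iteratedFDeriv ℝ n (lift (D t)) y‖ ≤ C) (l : List d) :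
    ContinuousOn (stLift fun r => iterPartialDeriv l (fun x => b r (x + proj (D r x)))) (Icc 0 T ×ˢ univ) ∧
      ∀ n : ℕ, ∃ C : ℝ, ∀ t ∈ Icc 0 T, ∀ y,
        ‖iteratedFDeriv ℝ n (lift (iterPartialDeriv l (fun x => b t (x + proj (D t x))))) y‖ ≤ C :=
  continuousOn_stLift_iterPartialDeriv_and_bounds (φ := fun r x => b r (x + proj (D r x)))
    (continuousOn_stLift_comp_flow hbc hDc) (fun _ hr => isSmooth_comp_flow hbs hDs hr)
    (exists_norm_iteratedFDeriv_comp_flow_le hbs hbB hDs hDB) l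

/-! ## §2 `∂^l D(s) = ∫₀ˢ ∂^l u(r) dr` -/

/-- **All label derivatives of the displacement are time integrals of the corresponding derivatives of the
composite**: `∂^l D(s)(x) = ∫₀ˢ ∂^l [y ↦ b(r, y + proj D(r,y))](x) dr` for `s ∈ [0,T]` and every word `l`
(induction on the word; each step differentiates under the integral sign along a label line).
[cite: Hartman2002, Ch. V Thm. 3.1 and Cor. 3.1 (differentiation of the integral equation)] -/
theorem iterPartialDeriv_disp_eq_integral (hbc : ContinuousOn (stLift b) (Icc 0 T ×ˢ univ))
    (hbs : ∀ t ∈ Icc 0 T, IsSmooth (b t))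
    (hbB : ∀ n : ℕ, ∃ C : ℝ, ∀ t ∈ Icc 0 T, ∀ y, ‖iteratedFDeriv ℝ n (lift (b t)) y‖ ≤ C)
    (hDc : ContinuousOn (stLift D) (Icc 0 T ×ˢ univ)) (hDs : ∀ t ∈ Icc 0 T, IsSmooth (D t))
    (hDB : ∀ n : ℕ, ∃ C : ℝ, ∀ t ∈ Icc 0 T, ∀ y, ‖iteratedFDeriv ℝ n (lift (D t)) y‖ ≤ C)
    (hint : ∀ s ∈ Icc 0 T, ∀ x, D s x = ∫ r in (0 : ℝ)..s, b r (x + proj (D r x))) :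
    ∀ (l : List d), ∀ s ∈ Icc 0 T, ∀ x : UnitAddTorus d,
      iterPartialDeriv l (D s) x = ∫ r in (0 : ℝ)..s, iterPartialDeriv l (fun y => b r (y + proj (D r y))) x
  | [], s, hs, x => by simpa using hint s hs x
  | j :: l, s, hs, x => by
    have IH := iterPartialDeriv_disp_eq_integral hbc hbs hbB hDc hDs hDB hint l
    obtain ⟨v, rfl⟩ := proj_surjective x
    have h0T : (0 : ℝ) ∈ Icc 0 T := ⟨le_rfl, hs.1.trans hs.2⟩
    have hsub : Ι 0 s ⊆ Icc 0 T := uIoc_subset_uIcc.trans (uIcc_subset_Icc h0T hs)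
    have hsub' : uIcc 0 s ⊆ Icc 0 T := uIcc_subset_Icc h0T hs
    set u : ℝ → UnitAddTorus d → EuclideanSpace ℝ d := fun r y => b r (y + proj (D r y)) with hu
    -- the word-`l` derivative of the composite: joint continuity and first-order bound; the next word too
    obtain ⟨hcl, hBl⟩ := continuousOn_stLift_iterPartialDeriv_comp_flow hbc hbs hbB hDc hDs hDB l
    obtain ⟨hcl', -⟩ := continuousOn_stLift_iterPartialDeriv_comp_flow hbc hbs hbB hDc hDs hDB (j :: l)
    obtain ⟨C1, hC1⟩ := hBl 1
    have hsl : ∀ r ∈ Icc 0 T, IsSmooth (iterPartialDeriv l (u r)) := fun r hr =>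
      (isSmooth_comp_flow hbs hDs hr).iterPartialDeriv l
    set e : EuclideanSpace ℝ d := EuclideanSpace.single j (1 : ℝ) with he
    have hne : ‖e‖ = 1 := by simp [he]
    -- the parametrised family along the label line `v + τ e`
    set F : ℝ → ℝ → EuclideanSpace ℝ d := fun τ r => lift (iterPartialDeriv l (u r)) (v + τ • e) with hF
    set F' : ℝ → ℝ → EuclideanSpace ℝ d := fun τ r =>
      _root_.fderiv ℝ (lift (iterPartialDeriv l (u r))) (v + τ • e) e with hF'
    have hdiff : ∀ r ∈ Icc 0 T, Differentiable ℝ (lift (iterPartialDeriv l (u r))) := fun r hr => by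
      have h : ContDiff ℝ ∞ (lift (iterPartialDeriv l (u r))) := hsl r hr
      exact h.differentiable (by simp)
    -- (i) derivative in `τ`
    have hderiv : ∀ r ∈ Icc 0 T, ∀ τ, HasDerivAt (fun τ => F τ r) (F' τ r) τ := by
      intro r hr τ
      have hℓ : HasDerivAt (fun τ : ℝ => v + τ • e) e τ := by
        simpa using ((hasDerivAt_id τ).smul_const e).const_add v
      exact ((hdiff r hr) (v + τ • e)).hasFDerivAt.comp_hasDerivAt τ hℓ
    -- (ii) bound on `F'`
    have hbound : ∀ r ∈ Icc 0 T, ∀ τ, ‖F' τ r‖ ≤ C1 := by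
      intro r hr τ
      have h1 : ‖_root_.fderiv ℝ (lift (iterPartialDeriv l (u r))) (v + τ • e)‖ ≤ C1 := by
        rw [← norm_iteratedFDeriv_one]; exact hC1 r hr _
      calc ‖F' τ r‖ ≤ ‖_root_.fderiv ℝ (lift (iterPartialDeriv l (u r))) (v + τ • e)‖ * ‖e‖ :=
            ContinuousLinearMap.le_opNorm _ _
        _ ≤ C1 * 1 := by rw [hne]; exact mul_le_mul_of_nonneg_right h1 zero_le_one
        _ = C1 := mul_one _
    -- (iii) continuity in `r` of the family and of its derivative at `τ = 0`
    have hFcont : ∀ τ, ContinuousOn (F τ) (Icc 0 T) := fun τ =>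
      hcl.comp (continuousOn_id.prodMk continuousOn_const) fun r hr => mk_mem_prod hr (mem_univ _)
    have hF'0 : ∀ r ∈ Icc 0 T, F' 0 r = lift (iterPartialDeriv (j :: l) (u r)) v := by
      intro r hr
      simp only [hF', zero_smul, add_zero]
      rw [iterPartialDeriv_cons, he]
      exact (congrFun (lift_lineDeriv ((hsl r hr).isContDiff (by simp)) (EuclideanSpace.single j (1 : ℝ))) v).symm
    have hF'cont : ContinuousOn (F' 0) (Icc 0 T) := by
      refine ContinuousOn.congr (f := fun r => lift (iterPartialDeriv (j :: l) (u r)) v) ?_ hF'0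
      exact hcl'.comp (continuousOn_id.prodMk continuousOn_const) fun r hr => mk_mem_prod hr (mem_univ _)
    have hmain := intervalIntegral.hasDerivAt_integral_of_dominated_loc_of_deriv_le (μ := volume)
      (F := F) (F' := F') (x₀ := (0 : ℝ)) (a := 0) (b := s) (s := univ) (bound := fun _ => C1)
      univ_mem
      (Eventually.of_forall fun τ => ((hFcont τ).mono hsub).aestronglyMeasurable measurableSet_uIoc)
      (((hFcont 0).mono hsub').intervalIntegrable)
      ((hF'cont.mono hsub).aestronglyMeasurable measurableSet_uIoc)
      (Eventually.of_forall fun r hr τ _ => hbound r (hsub hr) τ)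
      intervalIntegrable_const
      (Eventually.of_forall fun r hr τ _ => hderiv r (hsub hr) τ)
    -- (iv) by the induction hypothesis the family integrates to `lift (∂^l D s)` along the line
    have hFint : ∀ τ, ∫ r in (0 : ℝ)..s, F τ r = lift (iterPartialDeriv l (D s)) (v + τ • e) := by
      intro τ
      rw [lift_apply, IH s hs (proj (v + τ • e))]
      rfl
    have hD' : HasDerivAt (fun τ : ℝ => lift (iterPartialDeriv l (D s)) (v + τ • e)) (∫ r in (0 : ℝ)..s, F' 0 r) 0 := by
      have h := hmain.2
      simp only [hFint] at h
      exact h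
    -- (v) the torus partial derivative is the `τ`-derivative at `0`
    have hpd : iterPartialDeriv (j :: l) (D s) (proj v) =
        deriv (fun τ : ℝ => lift (iterPartialDeriv l (D s)) (v + τ • e)) 0 := by
      rw [iterPartialDeriv_cons]
      show deriv (fun τ : ℝ => iterPartialDeriv l (D s) (proj v + proj (τ • EuclideanSpace.single j (1 : ℝ)))) 0 = _
      rfl
    rw [hpd, hD'.deriv]
    refine intervalIntegral.integral_congr fun r hr => ?_
    rw [uIcc_of_le hs.1] at hr
    rw [hF'0 r ⟨hr.1, hr.2.trans hs.2⟩, lift_apply]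

/-! ## §3 The chain rule on steroids within `[0,T]` -/

/-- **`∂ₛ ∂^l D = ∂^l (b ∘ X)` within the window, vector form**: for `s ∈ [0,T]` and a label `x`,
`u ↦ ∂^l D(u)(x)` has, within `[0,T]`, the derivative `∂^l [y ↦ b(s, y + proj D(s,y))](x)` at `s`
(fundamental theorem of calculus on §2; the integrand is continuous in time by Landau interpolation).
[cite: Hartman2002, Ch. V Thm. 3.1 and Cor. 3.1; ArmstrongVicol2025, App. A Prop. 7.11 ((eq:chain:rule:steroids))] -/
theorem hasDerivWithinAt_iterPartialDeriv_disp_vec (hbc : ContinuousOn (stLift b) (Icc 0 T ×ˢ univ))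
    (hbs : ∀ t ∈ Icc 0 T, IsSmooth (b t))
    (hbB : ∀ n : ℕ, ∃ C : ℝ, ∀ t ∈ Icc 0 T, ∀ y, ‖iteratedFDeriv ℝ n (lift (b t)) y‖ ≤ C)
    (hDc : ContinuousOn (stLift D) (Icc 0 T ×ˢ univ)) (hDs : ∀ t ∈ Icc 0 T, IsSmooth (D t))
    (hDB : ∀ n : ℕ, ∃ C : ℝ, ∀ t ∈ Icc 0 T, ∀ y, ‖iteratedFDeriv ℝ n (lift (D t)) y‖ ≤ C)
    (hint : ∀ s ∈ Icc 0 T, ∀ x, D s x = ∫ r in (0 : ℝ)..s, b r (x + proj (D r x)))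
    (l : List d) {s : ℝ} (hs : s ∈ Icc 0 T) (x : UnitAddTorus d) :
    HasDerivWithinAt (fun u => iterPartialDeriv l (D u) x)
      (iterPartialDeriv l (fun y => b s (y + proj (D s y))) x) (Icc 0 T) s := by
  obtain ⟨v, rfl⟩ := proj_surjective x
  obtain ⟨hcl, -⟩ := continuousOn_stLift_iterPartialDeriv_comp_flow hbc hbs hbB hDc hDs hDB l
  set g : ℝ → EuclideanSpace ℝ d := fun r => iterPartialDeriv l (fun y => b r (y + proj (D r y))) (proj v) with hg
  have hgc : ContinuousOn g (Icc 0 T) := by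
    have h := hcl.comp (continuousOn_id.prodMk continuousOn_const) fun r hr => mk_mem_prod hr (mem_univ v)
    refine h.congr fun r _ => ?_
    simp only [hg, comp_apply, id_eq, stLift_apply]
  have h0T : (0 : ℝ) ∈ Icc 0 T := ⟨le_rfl, hs.1.trans hs.2⟩
  haveI : Fact (s ∈ Icc 0 T) := ⟨hs⟩
  have hFTC : HasDerivWithinAt (fun u => ∫ r in (0 : ℝ)..u, g r) (g s) (Icc 0 T) s :=
    intervalIntegral.integral_hasDerivWithinAt_right ((hgc.mono (uIcc_subset_Icc h0T hs)).intervalIntegrable)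
      (hgc.stronglyMeasurableAtFilter_nhdsWithin measurableSet_Icc s) (hgc s hs)
  refine hFTC.congr (fun u hu => ?_) ?_
  · exact iterPartialDeriv_disp_eq_integral hbc hbs hbB hDc hDs hDB hint l u hu (proj v)
  · exact iterPartialDeriv_disp_eq_integral hbc hbs hbB hDc hDs hDB hint l s hs (proj v)

/-- **`∂ₛ ∂^l Dᵢ = ∂^l (bᵢ ∘ X)` within the window, componentwise** — the hypothesis `hDt` of
`TorusFlow.dnorm_flowGrad_le_forward_ofDerivWithin`, for every `s ∈ [0,T]`.
[cite: Hartman2002, Ch. V Thm. 3.1 and Cor. 3.1; ArmstrongVicol2025, App. A Prop. 7.11 ((eq:chain:rule:steroids))] -/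
theorem hasDerivWithinAt_iterPartialDeriv_disp (hbc : ContinuousOn (stLift b) (Icc 0 T ×ˢ univ))
    (hbs : ∀ t ∈ Icc 0 T, IsSmooth (b t))
    (hbB : ∀ n : ℕ, ∃ C : ℝ, ∀ t ∈ Icc 0 T, ∀ y, ‖iteratedFDeriv ℝ n (lift (b t)) y‖ ≤ C)
    (hDc : ContinuousOn (stLift D) (Icc 0 T ×ˢ univ)) (hDs : ∀ t ∈ Icc 0 T, IsSmooth (D t))
    (hDB : ∀ n : ℕ, ∃ C : ℝ, ∀ t ∈ Icc 0 T, ∀ y, ‖iteratedFDeriv ℝ n (lift (D t)) y‖ ≤ C)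
    (hint : ∀ s ∈ Icc 0 T, ∀ x, D s x = ∫ r in (0 : ℝ)..s, b r (x + proj (D r x)))
    (l : List d) (i : d) (x : UnitAddTorus d) {s : ℝ} (hs : s ∈ Icc 0 T) :
    HasDerivWithinAt (fun u => iterPartialDeriv l (fun y => D u y i) x)
      (iterPartialDeriv l (fun y => b s (y + proj (D s y)) i) x) (Icc 0 T) s := by
  have hvec := hasDerivWithinAt_iterPartialDeriv_disp_vec hbc hbs hbB hDc hDs hDB hint l hs x
  have hcomp : HasDerivWithinAt (fun u => (iterPartialDeriv l (D u) x) i)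
      ((iterPartialDeriv l (fun y => b s (y + proj (D s y))) x) i) (Icc 0 T) s :=
    ((EuclideanSpace.proj i : EuclideanSpace ℝ d →L[ℝ] ℝ).hasFDerivAt).comp_hasDerivWithinAt s hvec
  refine (hcomp.congr (fun u hu => ?_) ?_).congr_deriv ?_
  · rw [iterPartialDeriv_apply_coord (hDs u hu) i l]
  · rw [iterPartialDeriv_apply_coord (hDs s hs) i l]
  · rw [iterPartialDeriv_apply_coord (isSmooth_comp_flow hbs hDs hs) i l]

/-- **Continuity in time of every label derivative of the displacement** on `[0,T]` (for each label and
component). [cite: Hartman2002, Ch. V Thm. 3.1] -/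
theorem continuousOn_iterPartialDeriv_disp (hbc : ContinuousOn (stLift b) (Icc 0 T ×ˢ univ))
    (hbs : ∀ t ∈ Icc 0 T, IsSmooth (b t))
    (hbB : ∀ n : ℕ, ∃ C : ℝ, ∀ t ∈ Icc 0 T, ∀ y, ‖iteratedFDeriv ℝ n (lift (b t)) y‖ ≤ C)
    (hDc : ContinuousOn (stLift D) (Icc 0 T ×ˢ univ)) (hDs : ∀ t ∈ Icc 0 T, IsSmooth (D t))
    (hDB : ∀ n : ℕ, ∃ C : ℝ, ∀ t ∈ Icc 0 T, ∀ y, ‖iteratedFDeriv ℝ n (lift (D t)) y‖ ≤ C)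
    (hint : ∀ s ∈ Icc 0 T, ∀ x, D s x = ∫ r in (0 : ℝ)..s, b r (x + proj (D r x)))
    (l : List d) (i : d) (x : UnitAddTorus d) :
    ContinuousOn (fun u => iterPartialDeriv l (fun y => D u y i) x) (Icc 0 T) := fun _ hs =>
  (hasDerivWithinAt_iterPartialDeriv_disp hbc hbs hbB hDc hDs hDB hint l i x hs).continuousWithinAt

end TorusFlow

end Literature.Analysis.ODE

end
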